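import Summits.BirchSwinnertonDyer.BirchSwinnertonDyer.Theorems.ResidualThetaTransportAtTwoRlfTwistedCasselsOfLevel
import Literature.NumberTheory.EllipticCurves.ZpExtensionGaloisTwistLevel
import HarnessLib

/-!
# (TCAS♯) from the EVENTUAL level-`K` twisted Cassels statement and the twisted local `Γ`-descent at `S₀`

Route `ResidualThetaTransportAtTwo` (RTT, crux r201 `ResidualLambdaFormulaNegDiscAtTwo`, stmt-BirchSwinnertonDyer-23110) /
`ThetaPartnerAtTwo` (TP2). Seat `prover-bsd-wall-tp2-p2x` g12 (`--supports stmt-BirchSwinnertonDyer-23110`). THEOREMS ONLY (no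
definition, no named fact, no `sorry`); closes nothing by itself.

CORRECTION of the level-`K` input of `twistedCassels_sharp_of_level` (`…RlfTwistedCasselsOfLevel`): the FIXED-level form
(TCAS-K) «every family `(t_v)_{v ∈ S₀}` of level `J` is `(res_v x)` for an `x` of the SAME level» is too strong — by finite-level
Poitou–Tate its obstruction is the dual Selmer group `H¹_{𝓛*}(K, E[p^J](χ_u)^*)`, a subgroup of the finite group `S_{A_{-s}}(K)`
that need not vanish at any fixed level. What Greenberg's argument (LNM 1716, p. 124: surjectivity of
`γ : H¹(F_Σ/F, A_s) → 𝒫^Σ(A_s, F)` for the DIVISIBLE module `A_s`, from `S_{A_{-s}}(F)` finite and `A_{-s}(F) = 0`) gives at finite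
level is the EVENTUAL form: a family of level `J` is hit after pushing it to some level `J' ≥ J` along
`ι : E[p^J](χ_u) ↪ E[p^{J'}](χ_u)` (`W.twistedTorsionIncl`; `lim_→ coker γ_J = coker γ_∞ = 0`, the transition maps of the dual
tower being multiplication by `p` on the finite group `S_{A_{-s}}(F)`, whose Tate module vanishes). This file proves
(TCAS♯) ⟸ (TCAS-K-eventual) + (LOC-S₀) with the same proof as before plus the level-change compatibility
`twistedTorsionToLocalH1 ∘ H¹(ι) = twistedTorsionToLocalH1` (`WeierstrassCurve.twistedTorsionToLocalH1_map_incl`).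

* `twistedCassels_sharp_of_eventualLevel` — (TCAS♯)(u) for the local data `(N, g)` from
  (hlev) `∀ J (t_v), ∃ J' ≥ J, ∃ x ∈ H¹(Γ_K, E[p^{J'}](χ_u))`, `twistedTorsionToH1 x ∈ Sel♯_{S₀}` and `res_v x = H¹(ι)(t_v)` on `S₀`,
  and (hloc) = (LOC-S₀) verbatim as in `twistedCassels_sharp_of_level` (now a THEOREM for every number field:
  `WeierstrassCurve.exists_twistedTorsionToLocalH1_eq_of_zsmul_conjH1_eq`, Literature `ZpExtensionGaloisTwistLocalDescentProofs`,
  given the local character `κ_E` with kernel the local subgroup and `κ_E(g_v) = 1`).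

HONEST FRAMING: closes nothing; (TCAS-K-eventual) is Greenberg's generalized Cassels theorem (Prop. 4.13 and its Remark, p. 122,
for `M = A_s`) read at finite levels — NOT proved here; 23110 is NOT proved; BSD is not proved by any of this.
References: [GreenbergLNM1716] §4 Prop. 4.13 + Remark (pp. 120–122), proof of Prop. 4.14 (pp. 123–124).
-/

-- the Theorems namespace of this sub repeats the summit name by design (D-0017 nested layout)
set_option linter.dupNamespace false

noncomputable section

open scoped Classical NumberField

open NumberField IsDedekindDomain

universe u

namespace Summit.BirchSwinnertonDyer.BirchSwinnertonDyer.Theorems.SignedEC.TwistedSurj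

open Literature.NumberTheory.EllipticCurves Literature.NumberTheory.GaloisRepresentations
  WeierstrassCurve ZpExtension Literature.NumberTheory.EllipticCurves.Kobayashi2003
  Literature.NumberTheory.EllipticCurves.GreenbergVatsal2000

variable {K : Type u} [Field K] [NumberField K] (W : WeierstrassCurve K) (p : ℕ) [Fact p.Prime]

/-- **(TCAS♯) ⟸ (TCAS-K, EVENTUAL form) + (LOC-S₀).** `K` a number field, `p` prime, `κ` a `ℤ_p`-extension with topological
generator `γ`, `ε` a sign, `S₀` finite, `u ≡ 1 (mod p)`, local data `N`, `g`. If every family of local classes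
`t_v ∈ H¹(Γ_{K_v}, E[p^J](χ_u))` (`v ∈ S₀`) becomes, after pushing to some level `J' ≥ J`, the family `(res_v x)` of a class
`x ∈ H¹(Γ_K, E[p^{J'}](χ_u))` with `twistedTorsionToH1 x ∈ Sel♯_{S₀}` (TCAS-K-eventual = Greenberg's generalized Cassels theorem for
`A_s` read at finite levels), and if (LOC-S₀) holds at each `v ∈ S₀`, then (TCAS♯): every family of `p`-power-torsion twisted
eigenvectors `(z_v)_{v ∈ S₀}` is `(loc_v c)` for a `c ∈ Sel♯_{S₀}(E/K_∞)` with `u·conj_γ c = c`.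
[cite: GreenbergLNM1716, §4 Prop. 4.13 Remark (p. 122), proof of Prop. 4.14 (p. 124), pp. 107–108] -/
theorem twistedCassels_sharp_of_eventualLevel (κ : ZpExtension K p) (ε : ℤˣ) {γ : Field.absoluteGaloisGroup K}
    (hγ : κ.IsTopGenerator γ) (S₀ : Finset (HeightOneSpectrum (𝓞 K))) {u : ℤ} (hu : (p : ℤ) ∣ u - 1)
    (N : HeightOneSpectrum (𝓞 K) → ℕ)
    (g : ∀ v : HeightOneSpectrum (𝓞 K), Field.absoluteGaloisGroup (v.adicCompletion K))
    (hlev : ∀ (J : ℕ) (t : ∀ v : HeightOneSpectrum (𝓞 K),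
        galoisCohomology ((W.twistedTorsionGaloisModule p κ J u hu).restrictField (v.adicCompletion K)) 1),
      ∃ (J' : ℕ) (hJ : J ≤ J') (x : galoisCohomology (W.twistedTorsionGaloisModule p κ J' u hu) 1),
        W.twistedTorsionToH1 p κ J' u hu x ∈
            unramifiedOutside κ.kerSubgroup ↥(W.geomPrimaryTorsion p) p (↑S₀ : Set (HeightOneSpectrum (𝓞 K))) ⊓
              ⨅ (v : HeightOneSpectrum (𝓞 K)) (_ : ((p : ℕ) : 𝓞 K) ∈ v.asIdeal) (σ : Field.absoluteGaloisGroup K),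
                (localKummerOverOfEmb W p κ.kerSubgroup (closureEmb (K := K) (v.adicCompletion K))
                  (⨆ n : ℕ, signedLocalPoints κ (v.adicCompletion K) W ε n)).comap (W.conjH1 p κ.kerSubgroup σ) ∧
          ∀ v ∈ S₀, galoisCohomology.res (W.twistedTorsionGaloisModule p κ J' u hu) (v.adicCompletion K) 1 x =
            galoisCohomology.map ((W.twistedTorsionIncl p κ hJ u hu).restrictField (v.adicCompletion K)) 1 (t v))
    (hloc : ∀ v ∈ S₀, ∀ z : discreteH1 (localSubgroup κ.kerSubgroup (v.adicCompletion K)) (localPoints W (v.adicCompletion K)),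
      (∃ k : ℕ, p ^ k • z = 0) →
      u ^ N v • Literature.NumberTheory.EllipticCurves.conjH1 (localSubgroup κ.kerSubgroup (v.adicCompletion K))
          (localPoints W (v.adicCompletion K)) (g v) z = z →
      ∃ J₀ : ℕ, ∀ J : ℕ, J₀ ≤ J →
        ∃ t : galoisCohomology ((W.twistedTorsionGaloisModule p κ J u hu).restrictField (v.adicCompletion K)) 1,
          W.twistedTorsionToLocalH1 p κ J u hu (v.adicCompletion K) t = z)
    (z : ∀ v : HeightOneSpectrum (𝓞 K),
      discreteH1 (localSubgroup κ.kerSubgroup (v.adicCompletion K)) (localPoints W (v.adicCompletion K)))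
    (hztor : ∀ v ∈ S₀, ∃ k : ℕ, p ^ k • z v = 0)
    (hzeig : ∀ v ∈ S₀, u ^ N v • Literature.NumberTheory.EllipticCurves.conjH1 (localSubgroup κ.kerSubgroup (v.adicCompletion K))
        (localPoints W (v.adicCompletion K)) (g v) (z v) = z v) :
    ∃ c ∈ unramifiedOutside κ.kerSubgroup ↥(W.geomPrimaryTorsion p) p (↑S₀ : Set (HeightOneSpectrum (𝓞 K))) ⊓
        ⨅ (v : HeightOneSpectrum (𝓞 K)) (_ : ((p : ℕ) : 𝓞 K) ∈ v.asIdeal) (σ : Field.absoluteGaloisGroup K),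
          (localKummerOverOfEmb W p κ.kerSubgroup (closureEmb (K := K) (v.adicCompletion K))
            (⨆ n : ℕ, signedLocalPoints κ (v.adicCompletion K) W ε n)).comap (W.conjH1 p κ.kerSubgroup σ),
      u • W.conjH1 p κ.kerSubgroup γ c = c ∧
        ∀ v ∈ S₀, W.localResOver p κ.kerSubgroup (v.adicCompletion K) c = z v := by
  -- the eventual levels at the places of `S₀` (junk `0` elsewhere)
  have hJ : ∀ v : HeightOneSpectrum (𝓞 K), ∃ J₀ : ℕ, v ∈ S₀ → ∀ J : ℕ, J₀ ≤ J →
      ∃ t : galoisCohomology ((W.twistedTorsionGaloisModule p κ J u hu).restrictField (v.adicCompletion K)) 1,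
        W.twistedTorsionToLocalH1 p κ J u hu (v.adicCompletion K) t = z v := by
    intro v
    by_cases hv : v ∈ S₀
    · obtain ⟨J₀, hJ₀⟩ := hloc v hv (z v) (hztor v hv) (hzeig v hv)
      exact ⟨J₀, fun _ ↦ hJ₀⟩
    · exact ⟨0, fun h ↦ absurd h hv⟩
  choose J₀ hJ₀ using hJ
  -- a common level `J ≥ J₀ v` for all `v ∈ S₀`
  set J : ℕ := S₀.sup J₀ with hJdef
  have hJle : ∀ v ∈ S₀, J₀ v ≤ J := fun v hv ↦ Finset.le_sup (f := J₀) hv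
  -- the local classes at level `J`
  have ht : ∀ v : HeightOneSpectrum (𝓞 K), ∃ t :
      galoisCohomology ((W.twistedTorsionGaloisModule p κ J u hu).restrictField (v.adicCompletion K)) 1,
      v ∈ S₀ → W.twistedTorsionToLocalH1 p κ J u hu (v.adicCompletion K) t = z v := by
    intro v
    by_cases hv : v ∈ S₀
    · obtain ⟨t, ht⟩ := hJ₀ v hv J (hJle v hv)
      exact ⟨t, fun _ ↦ ht⟩
    · exact ⟨0, fun h ↦ absurd h hv⟩
  choose t ht using ht
  -- (TCAS-K, eventual form) from level `J` to some level `J' ≥ J`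
  obtain ⟨J', hJ', x, hxS, hxt⟩ := hlev J t
  refine ⟨W.twistedTorsionToH1 p κ J' u hu x, hxS, W.zsmul_conjH1_twistedTorsionToH1 p κ J' u hu hγ x, fun v hv ↦ ?_⟩
  rw [W.localResOver_twistedTorsionToH1 p κ J' u hu (v.adicCompletion K) x, hxt v hv,
    W.twistedTorsionToLocalH1_map_incl p κ hJ' u hu (v.adicCompletion K) (t v)]
  exact ht v hv

end Summit.BirchSwinnertonDyer.BirchSwinnertonDyer.Theorems.SignedEC.TwistedSurj

end
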